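import Summits.QuantumAdvantage.QuantumAdvantage.Theorems.CharDialTransferDialJ
import HarnessLib

/-!
# TransferDial K — the leaf sharpened: thinness is consumed only at BOUNDED CO-DIMENSION; local-to-global for slice counts modulo PF

The proof of `RainbowBound` (parts G–J) uses the hypothesis `rowCount f S ≤ R` only for the two bipartitions `S = Y'ᶜ`, `S = W₁ᶜ` whose
complements have `T(R) = 5((R·R)^R+1)+1` resp. `T(R) − 1` elements (`coDim R`).  Hence (`Model.rainbowBound_coSmall`) a rainbow bound
already follows from thinness at co-dimension `≤ coDim R`, and the algebraic leaf of the SliceDial carving may be stated as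
`SliceFewCoSmallTwoOdd`: at `𝔽_p`-degree `≤ 2p − 3` there is an `R(p)` such that the restrictions of `f` to ANY `≤ coDim R(p)` coordinates,
over all backgrounds, take `≤ R(p)` distinct shapes.  Kernel consequences: `partnersTwoOdd_of_sliceFewCoSmall`; modulo the field core PF,
`structureLaw_iff_sliceFewCoSmall_of_PF : StructureLawTwoOdd ↔ SliceFewCoSmallTwoOdd` and the LOCAL-TO-GLOBAL statement
`sliceFew_iff_coSmall_of_PF : SliceFewTwoOdd ↔ SliceFewCoSmallTwoOdd` (bounded row counts at bounded co-dimension ⟹ bounded row counts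
for every bipartition — through few types and the structure law).  CAUTION (quantitative crux, recorded for g24): the budget `R` and the
co-dimension `coDim R` are COUPLED (a fixed point); a bound `R(p, t)` growing with the co-dimension `t` — e.g. the trivial
`p^{#monomials of degree ≤ 2p−3 on t variables}` — does not feed this theorem.

Tree twin, part K of the decomp-qadv lens-6 g23 addendum (the proof of `rainbowBound_coSmall` is the part-J proof of `rainbowBound` with the
two thinness invocations justified by `compl_compl`; everything else is one-line glue).  0 sorry; no `instance`, no `notation`, no `native_decide`.
-/

set_option autoImplicit false
set_option linter.dupNamespace false

namespace Summit.QuantumAdvantage.QuantumAdvantage.Theorems.TransferDial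

open Classical
open Finset
open Summit.QuantumAdvantage.AdviceFreeQNC0

/-- The co-dimension at which the `RainbowBound` proof consumes thinness `R`: `5((R·R)^R + 1) + 1`. -/
def coDim (R : ℕ) : ℕ := 5 * ((R * R) ^ R + 1) + 1

/-- SLICE-FEW at degree `d`, row budget `R`, for bipartitions of CO-DIMENSION `≤ T` only (restrictions to `≤ T` coordinates). -/
def SliceFewCoSmallAt (p : ℕ) [Fact p.Prime] (d R T : ℕ) : Prop :=
  ∀ (m : ℕ) (f : (Fin m → Bool) → Bool), HasDegF p f d → ∀ S : Finset (Fin m), Sᶜ.card ≤ T → rowCount f S ≤ R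

/-- ★ THE SHARPENED LEAF (OPEN): at degree `≤ 2p − 3`, some budget `R(p)` bounds the row count of every bipartition of co-dimension
`≤ coDim R(p)` — «restrictions to boundedly many coordinates take boundedly many shapes», with the bound and the co-dimension coupled. -/
def SliceFewCoSmallTwoOdd : Prop :=
  ∀ (p : ℕ) [Fact p.Prime], 5 ≤ p → ∃ R : ℕ, SliceFewCoSmallAt p (2 * p - 3) R (coDim R)

/-- The global slice-count statement implies the co-small one (trivial direction). -/
theorem sliceFewCoSmall_of_sliceFew (h : SliceFewTwoOdd) : SliceFewCoSmallTwoOdd := by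
  intro p _ hp
  obtain ⟨R, hR⟩ := h p hp
  exact ⟨R, fun m f hf S _ => hR m f hf S⟩

namespace Model

open Summit.QuantumAdvantage.QuantumAdvantage.Theorems.TransferDial.HomSys

/-- ★ `RainbowBound` from thinness at co-dimension `≤ coDim R` only (the part-J proof, with the two thinness invocations localised). -/
theorem rainbowBound_coSmall (R : ℕ) : ∃ N : ℕ, ∀ (m : ℕ) (f : (Fin m → Bool) → Bool),
    (∀ S : Finset (Fin m), Sᶜ.card ≤ coDim R → rowCount f S ≤ R) →
      ∀ Y : Finset (Fin m), Rainbow f Y → Y.card ≤ N := by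
  unfold coDim
  obtain ⟨N, hN⟩ := exists_hom (5 * ((R * R) ^ R + 1) + 1) (5 * ((R * R) ^ R + 1)) (by omega)
  refine ⟨N, fun m f hthin Y hY => ?_⟩
  by_contra hlt
  obtain ⟨Y', hY'Y, hcard, hhom⟩ := hN m f Y (by omega)
  -- abbreviations
  have hA : (R * R) ^ R < (R * R) ^ R + 1 := by omega
  have hhom2 : ∀ ℓ, 2 ≤ ℓ → ℓ ≤ 5 * ((R * R) ^ R + 1) + 1 → ∀ W₁, W₁ ⊆ Y' → W₁.card = ℓ →
      ∀ W₂, W₂ ⊆ Y' → W₂.card = ℓ → ∀ ψ, Phi f W₁ ψ ↔ Phi f W₂ ψ := by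
    intro ℓ h1 h2 W₁ s1 c1 W₂ s2 c2 ψ
    apply Phi_iff_of_col_eq f (5 * ((R * R) ^ R + 1) + 1) (by omega) (by omega)
    exact hhom ℓ (by omega) h2 W₁ (mem_powersetCard.2 ⟨s1, c1⟩) W₂ (mem_powersetCard.2 ⟨s2, c2⟩)
  -- generalize T
  generalize hT : 5 * ((R * R) ^ R + 1) + 1 = T at hcard hhom2
  clear hhom
  have hT5 : 5 * ((R * R) ^ R + 1) + 1 ≤ T := by omega
  have hT3 : 3 ≤ T := by omega
  -- the restriction system
  let Ψ : ℕ → ((ℕ → Bool) → Bool) → Prop := fun ℓ ψ => ∃ W, W ⊆ Y' ∧ W.card = ℓ ∧ Phi f W ψ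
  obtain ⟨W₁, hW₁, hcW₁⟩ := exists_subset_card_eq (show T - 1 ≤ Y'.card by omega)
  have hΦt : ∀ ψ, Ψ T ψ ↔ ψ ∈ PhiF f Y' := by
    intro ψ
    constructor
    · rintro ⟨W, hW, hc, hphi⟩
      have : W = Y' := eq_of_subset_of_card_le hW (by rw [hc, hcard])
      subst this
      exact (mem_PhiF f _ ψ).2 hphi
    · intro h; exact ⟨Y', subset_rfl, hcard, (mem_PhiF f _ ψ).1 h⟩
  have hΦt1 : ∀ ψ, Ψ (T - 1) ψ ↔ ψ ∈ PhiF f W₁ := by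
    intro ψ
    constructor
    · rintro ⟨W, hW, hc, hphi⟩
      exact (mem_PhiF f _ ψ).2 ((hhom2 (T - 1) (by omega) (by omega) W hW hc W₁ hW₁ hcW₁ ψ).1 hphi)
    · intro h; exact ⟨W₁, hW₁, hcW₁, (mem_PhiF f _ ψ).1 h⟩
  have hct : (PhiF f Y').card ≤ R :=
    (card_PhiF_le f Y').trans (hthin _ (by rw [compl_compl, hcard]; omega))
  have hct1 : (PhiF f W₁).card ≤ R :=
    (card_PhiF_le f W₁).trans (hthin _ (by rw [compl_compl, hcW₁]; omega))
  have hclosed : ∀ ψ, Ψ T ψ → ∀ s, s < T → ∀ c, Ψ (T - 1) (resN s c ψ) := by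
    rintro ψ ⟨W, hW, hc, ⟨b, rfl⟩⟩ s hs c
    obtain ⟨w, hw, hrk⟩ := exists_rk_eq W s (by omega)
    have e := resN_psi f W b hw c
    rw [hrk] at e
    rw [e]
    exact ⟨W.erase w, (erase_subset _ _).trans hW, by rw [card_erase_of_mem hw, hc], _, rfl⟩
  have hreads : ∀ ℓ ψ, Ψ ℓ ψ → Reads ℓ ψ := by
    rintro ℓ ψ ⟨W, _, hc, ⟨b, rfl⟩⟩
    rw [← hc]
    exact reads_psi f W b
  have hsurj : ∀ ℓ, 2 ≤ ℓ → ℓ < T → ∀ ψ', Ψ ℓ ψ' → ∀ p, p ≤ ℓ →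
      ∃ ψ c, Ψ (ℓ + 1) ψ ∧ resN p c ψ = ψ' := by
    rintro ℓ h1 h2 ψ' ⟨W', hW', hc', hphi'⟩ p hp
    obtain ⟨W, hW, hcW⟩ := exists_subset_card_eq (show ℓ + 1 ≤ Y'.card by omega)
    obtain ⟨w, hw, hrk⟩ := exists_rk_eq W p (by omega)
    have hcE : (W.erase w).card = ℓ := by rw [card_erase_of_mem hw, hcW]; simp
    have hphi : Phi f (W.erase w) ψ' :=
      (hhom2 ℓ h1 (by omega) W' hW' hc' (W.erase w) ((erase_subset _ _).trans hW) hcE ψ').1 hphi'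
    obtain ⟨b', rfl⟩ := hphi
    refine ⟨psi f W b', b' w, ⟨W, hW, hcW, b', rfl⟩, ?_⟩
    have e := resN_psi f W b' hw (b' w)
    rw [hrk, Function.update_eq_self] at e
    exact e
  have key := level_two_symmetric_of_thin (V := Bool) Ψ R ((R * R) ^ R + 1) T hA hT5 (PhiF f Y') (PhiF f W₁)
    hΦt hΦt1 hct hct1 hclosed hreads
    (fun ℓ h1 h2 ψ' hψ' => hsurj ℓ h1 h2 ψ' hψ' 0 (by omega))
    (fun ℓ h1 h2 ψ' hψ' => hsurj ℓ h1 h2 ψ' hψ' ℓ le_rfl)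
  -- two coordinates of Y' are exchangeable: contradiction with rainbowness
  obtain ⟨i, j, hi, hj, hij⟩ := one_lt_card_iff.1 (show 1 < Y'.card by omega)
  have main : ∀ i j : Fin m, i ∈ Y' → j ∈ Y' → i < j → False := by
    intro i j hi hj hlt
    apply hY i (hY'Y hi) j (hY'Y hj) (ne_of_lt hlt)
    intro u
    have hsub : ({i, j} : Finset (Fin m)) ⊆ Y' := insert_subset hi (singleton_subset_iff.2 hj)
    have hg : Ψ 2 (psi f {i, j} u) := ⟨{i, j}, hsub, card_pair (ne_of_lt hlt), u, rfl⟩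
    have hk := key _ hg (fun k => if k = 0 then u i else u j)
    have e1 : fill {i, j} u (fun k => if k = 0 then u i else u j) = u := by
      funext k
      unfold fill
      by_cases hk : k ∈ ({i, j} : Finset (Fin m))
      · rw [if_pos hk]
        simp only [mem_insert, mem_singleton] at hk
        rcases hk with rfl | rfl
        · rw [rk_pair_left hlt]; simp
        · rw [rk_pair_right hlt]; simp
      · rw [if_neg hk]
    have e2 : fill {i, j} u (swN 0 1 (fun k => if k = 0 then u i else u j)) = u ∘ Equiv.swap i j := by
      funext k
      unfold fill swN
      by_cases hk : k ∈ ({i, j} : Finset (Fin m))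
      · rw [if_pos hk]
        simp only [mem_insert, mem_singleton] at hk
        rcases hk with rfl | rfl
        · rw [rk_pair_left hlt]
          simp [Equiv.swap_apply_left]
        · rw [rk_pair_right hlt]
          simp [Equiv.swap_apply_right]
      · rw [if_neg hk]
        simp only [mem_insert, mem_singleton, not_or] at hk
        simp only [Function.comp_apply]
        rw [Equiv.swap_apply_of_ne_of_ne hk.1 hk.2]
    unfold psi at hk
    rw [e1, e2] at hk
    exact hk
  rcases lt_or_gt_of_ne hij with hlt | hgt
  · exact main i j hi hj hlt
  · exact main j i hj hi hgt

end Model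

/-- ★★ `PartnersTwoOdd ⟸ SliceFewCoSmallTwoOdd` (part F's glue `lonely_le_of_rainbow` with `Model.rainbowBound_coSmall`). -/
theorem partnersTwoOdd_of_sliceFewCoSmall (hS : SliceFewCoSmallTwoOdd) : PartnersTwoOdd := by
  intro p _ hp
  obtain ⟨R, hR⟩ := hS p hp
  obtain ⟨N, hN⟩ := Model.rainbowBound_coSmall R
  refine ⟨N * (3 * p - 2), fun m f hf => ?_⟩
  obtain ⟨L, hLc, hLp⟩ :=
    lonely_le_of_rainbow f N (3 * p - 2) fun Y hY => hN m f (fun S hS' => hR m f hf S hS') Y hY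
  exact ⟨L, hLc, fun i hi => hLp i hi⟩

/-- ★★★ Modulo the field core PF: piece B ⟺ the co-small slice-count statement. -/
theorem structureLaw_iff_sliceFewCoSmall_of_PF (hPF : FieldCorePerPrime) :
    StructureLawTwoOdd ↔ SliceFewCoSmallTwoOdd :=
  ⟨fun hB => sliceFewCoSmall_of_sliceFew (sliceFew_of_structureLaw hB),
   fun hS => closes_of_PF hPF (partnersTwoOdd_of_sliceFewCoSmall hS)⟩

/-- ★★ LOCAL-TO-GLOBAL for slice counts, modulo PF: bounded row counts at bounded co-dimension ⟹ bounded row counts for EVERY bipartition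
(through few types and the structure law; no direct argument is known). -/
theorem sliceFew_iff_coSmall_of_PF (hPF : FieldCorePerPrime) : SliceFewTwoOdd ↔ SliceFewCoSmallTwoOdd :=
  ⟨sliceFewCoSmall_of_sliceFew,
   fun h => sliceFew_of_structureLaw ((structureLaw_iff_sliceFewCoSmall_of_PF hPF).2 h)⟩

/-- info: 'Summit.QuantumAdvantage.QuantumAdvantage.Theorems.TransferDial.partnersTwoOdd_of_sliceFewCoSmall' depends on axioms: [propext,
 choice,
 Quot.sound] -/
#guard_msgs in #print axioms partnersTwoOdd_of_sliceFewCoSmall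
/-- info: 'Summit.QuantumAdvantage.QuantumAdvantage.Theorems.TransferDial.sliceFew_iff_coSmall_of_PF' depends on axioms: [propext,
 choice,
 Quot.sound] -/
#guard_msgs in #print axioms sliceFew_iff_coSmall_of_PF

end Summit.QuantumAdvantage.QuantumAdvantage.Theorems.TransferDial
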